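import Summits.QuantumFields.YangMills.Theorems.BalabanLadderIRScalingHeredity
import Summits.QuantumFields.YangMills.Theorems.BalabanLadderIRCofinalCouplingsSeam
import Summits.QuantumFields.YangMills.Theses.BalabanLadder
import HarnessLib

/-!
# basin-transfer × R423/R424 — the cofinal re-price of line 20, now BY NAME on `BalabanLadder.IRcof` (idea-9 g5, rev 2, 2026-08-28)

Rev 1 (g4, 2547dd290cea; crit-3 g2 08:30:36Z: kernel CERTIFIED, axioms trio, `CofinalExitAt θ ↔ ExitsUnboundedAt θ := Iff.rfl`)
re-priced line 20 against the cofinal bill `K1 ∧ X ∧ N` and proved `K1_of_A36_seed8cof : A36 → K1(1/8) → K1(1/24)`, citing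
`IRcof ⇐ K1(1/24) ∧ X ∧ N` by name only (the cofinal leaf `Lines/cofinal_leaf.lean` is not importable).

R424 (a) (route owner ym-beyond-p2 g33, 08:30:59Z; file rev 12 ef4d143071be): the Leg's IR slot is RE-TYPED — the served item is
`Summit.QuantumFields.YangMills.Theses.BalabanLadder.IRcof` (stmt-QuantumFields-26930), `BalabanLadder.IR` (stmt-QuantumFields-19354)
stays a declared supplier.  Rev 2 makes line 20's assembly token KERNEL-EXACT on the new decl, importing only LANDED modules:

* `IRcof_of_K1XN : CofinalExitAt (1/24) → AFToColdPressure → IRnsc → Theses.BalabanLadder.IRcof` — the cofinal bill concluded on the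
  ROUTE decl literally (simply-connected `G`: `Bset :=` the exit set, the landed per-β kernel
  `ColdPressurePincer.gapOn_exitSet_of_af` (Theorems/BalabanLadderIRCofinalCouplingsSeam.lean); other simple `G`: `Bset := univ` and N).
  This is the LEAD's `CofinalLeaf.IRcof_of` (Lines/cofinal_leaf.lean §4) re-proved over importable modules so that a Lines file can
  conclude the Theses decl — no new content is claimed; custody of the skeleton on 26930 stays with the LEAD / OWNER (g9-№1);
* `IRcof_of_A36_seed8cof : A36 → K1(1/8) → X → N → Theses.BalabanLadder.IRcof` — LINE 20's BILL BY NAME;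
* `IRcof_of_A36_seed8` (rev 8's seed `E(1/8)` still pays), `IRcof_of_exit64cof` (line 22's arithmetic: purity `≤ 2⁻⁶ ≤ 1/24`, no basin);
* `yangMills_of_line20` — summit probe: the spine's own `Theses.BalabanLadder.closes` with line 20's bill in the `IRcof` slot.

PRICE OF RECORD (unchanged by rev 2): line 20 closes `IRcof` modulo `{A36 = AbstractBasin (1/2^3) (1/24) (rank 2, abstract; cscan g0/g2/g3
NO KILL, Casimir-flat corner closed p615926; possibly false without a locality axiom [Loc]), K1(1/8) = CofinalExitAt (1/2^3) (YM content:
ONE ≥ 87.5 %-pure cold 4:1 torus of side ≥ 8, cofinally in β — not MC-instrumentable at this tolerance, eng-4 E4-G2 viii), X, N}`.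
WALL UNCHANGED (slavery: the basin IS the wall).  Count-neutral versus the leaf's `{K1(1/24), X, N}` unless A36 lands.

HONESTY: nothing here proves `A36`, `K1(θ)` for any `θ`, `IR`, `IRcof`, the Leg or the summit; the Yang–Mills mass gap (Clay) is
NOT proved by any of this; R4 closes only the conditional finite-𝕋⁴ rung `BalabanLadder.UV`.  No `sorry`, no new `def`.
-/

noncomputable section

open MeasureTheory Filter Topology
open Literature.MathematicalPhysics.QuantumFieldTheory Literature.MathematicalPhysics.QuantumLattice
open Summit.QuantumFields.YangMills.Cruxes.IR.ColdPurityBridge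
open Summit.QuantumFields.YangMills.Cruxes.IR.AspectBootstrap
open Summit.QuantumFields.YangMills.Cruxes.IR.ColdPressurePincer
open Summit.QuantumFields.YangMills.Cruxes.IR.BasinRung
open Summit.QuantumFields.YangMills.Cruxes.IR.ScalingHeredity
open Summit.QuantumFields.YangMills.Theses.BalabanLadder (UV UVSeamRec NT IRcof ROT UVOtherGroups)

namespace Summit.QuantumFields.YangMills.Cruxes.IR.BasinTransferCofinal

/-! ## §1 Cofinal transport by the abstract basin (rev 1, certified) -/

/-- **Cofinal transport by the abstract basin** (twin of `BasinRung.coldExitAt_of_abstractBasin`): an exit at tolerance `θ` on an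
unbounded set of couplings plus the abstract basin enlargement `θ ↦ ε` gives an exit at tolerance `ε` on an unbounded set of
couplings — pointwise in `β` (the witness coupling is taken `≥ max β₁ 0` so that the Wilson family is trace-positive with volume bounds). -/
theorem cofinalExitAt_of_abstractBasin {θ ε : ℝ} (hK : CofinalExitAt θ) (hA : AbstractBasin θ ε) : CofinalExitAt ε := by
  intro G _ _ _ _ hG hsc
  letI : MeasurableSpace G := borel G
  haveI : BorelSpace G := ⟨rfl⟩
  intro r β₁
  obtain ⟨β, hβ, L, hL, hδ⟩ := hK G hG hsc r (max β₁ 0)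
  have hββ₁ : β₁ ≤ β := le_trans (le_max_left _ _) hβ
  have hβ0 : 0 ≤ β := le_trans (le_max_right _ _) hβ
  rw [coldDefect_eq_boxDefect] at hδ
  obtain ⟨L', hL', hδ'⟩ := hA _ (axisSymmetric r β) (tracePositive r hβ0) (volumeBounds r hβ0) L hL hδ
  exact ⟨β, hββ₁, L', hL', by rw [coldDefect_eq_boxDefect]; exact hδ'⟩

/-- `K1` is monotone in the tolerance. -/
theorem cofinalExitAt_mono {θ θ' : ℝ} (h : θ ≤ θ') (hK : CofinalExitAt θ) : CofinalExitAt θ' := by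
  intro G _ _ _ _ hG hsc
  letI : MeasurableSpace G := borel G
  haveI : BorelSpace G := ⟨rfl⟩
  intro r β₁
  obtain ⟨β, hβ, L, hL, hδ⟩ := hK G hG hsc r β₁
  exact ⟨β, hβ, L, hL, hδ.trans h⟩

/-- **Line 20 re-priced (R423)**: `A36 ∧ K1(1/8) ⇒ K1(1/24)`. -/
theorem K1_of_A36_seed8cof (hA : AbstractBasin (1 / 2 ^ 3) (1 / 24)) (hK : CofinalExitAt (1 / 2 ^ 3)) :
    CofinalExitAt (1 / 24) :=
  cofinalExitAt_of_abstractBasin hK hA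

/-- The old seed still pays the new bill: `E(1/8) ⇒ K1(1/8)` (landed `ScalingHeredity.cofinal_of_coldExitAt`), so rev 8's
`{A36, seed8}` gives `K1(1/24)` as well — the re-typing only RELAXES the seed. -/
theorem K1_of_A36_seed8 (hA : AbstractBasin (1 / 2 ^ 3) (1 / 24)) (hS : ColdExitAt (1 / 2 ^ 3)) : CofinalExitAt (1 / 24) :=
  K1_of_A36_seed8cof hA (cofinal_of_coldExitAt hS)

/-- Conformal-exit (line 22) re-price needs no basin at all on the cofinal bill: its wall delivers purity `≤ 1/2^6 ≤ 1/24`, and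
`K1` is monotone — recorded as the arithmetic fact the bus line cites. -/
theorem K1_of_exit64cof (hK : CofinalExitAt (1 / 2 ^ 6)) : CofinalExitAt (1 / 24) :=
  cofinalExitAt_mono (by norm_num) hK

/-! ## §2 (rev 2, R424) The cofinal bill concluded on the ROUTE decl `Theses.BalabanLadder.IRcof` BY NAME -/

/-- **`K1(1/24) ∧ X ∧ N ⇒ Theses.BalabanLadder.IRcof`** (item stmt-QuantumFields-26930), over landed modules only.
Simply-connected `G`: `Bset := {β ≥ 0 | ∃ L ≥ 8, δᶜ_β(L) ≤ 1/24}` is unbounded above by K1 and carries the `GapInUnits`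
family by the landed per-β kernel `gapOn_exitSet_of_af` (AF pin X, onset at an exit, pincer, rate seam); other simple `G`:
`Bset := univ`, family = N.  (= the LEAD's `CofinalLeaf.IRcof_of`, re-proved here because Lines modules are not importable.) -/
theorem IRcof_of_K1XN (hK1 : CofinalExitAt (1 / 24)) (hX : AFToColdPressure) (hN : IRnsc) :
    Summit.QuantumFields.YangMills.Theses.BalabanLadder.IRcof := by
  intro G _ _ _ _ hG
  letI : MeasurableSpace G := borel G
  haveI : BorelSpace G := ⟨rfl⟩
  intro r a ha ha0 hlb
  by_cases hsc : SimplyConnectedSpace G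
  · refine ⟨{β : ℝ | 0 ≤ β ∧ ∃ L : ℕ, 8 ≤ L ∧ coldDefect r.ρ β L ≤ 1 / 24}, fun x => ?_,
      gapOn_exitSet_of_af hX G hG r a ha ha0 hlb⟩
    obtain ⟨β, hβ, L, hL, hδ⟩ := hK1 G hG hsc r (max x 0)
    exact ⟨β, ⟨le_trans (le_max_right _ _) hβ, L, hL, hδ⟩, le_trans (le_max_left _ _) hβ⟩
  · obtain ⟨c₁, β₂, S₁, hc₁, hfam⟩ := hN G hG hsc r a ha ha0 hlb
    refine ⟨Set.univ, fun x => ⟨x, Set.mem_univ x, le_rfl⟩, c₁, β₂, S₁, hc₁, fun A B => ?_⟩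
    obtain ⟨C, hC⟩ := hfam A B
    exact ⟨C, fun β _ hβ S n hS hn => hC β hβ S n hS hn⟩

/-- **LINE 20's BILL BY NAME (rev 2): `A36 → K1(1/8) → X → N → Theses.BalabanLadder.IRcof`.** -/
theorem IRcof_of_A36_seed8cof (hA : AbstractBasin (1 / 2 ^ 3) (1 / 24)) (hK : CofinalExitAt (1 / 2 ^ 3))
    (hX : AFToColdPressure) (hN : IRnsc) : Summit.QuantumFields.YangMills.Theses.BalabanLadder.IRcof :=
  IRcof_of_K1XN (K1_of_A36_seed8cof hA hK) hX hN

/-- Rev 8's registered stub set `{A36, seed8 = E(1/8), X, N}` (Lines/basin_transfer.lean, concluding `IR`'s supplier chain) also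
pays the re-typed slot by name. -/
theorem IRcof_of_A36_seed8 (hA : AbstractBasin (1 / 2 ^ 3) (1 / 24)) (hS : ColdExitAt (1 / 2 ^ 3))
    (hX : AFToColdPressure) (hN : IRnsc) : Summit.QuantumFields.YangMills.Theses.BalabanLadder.IRcof :=
  IRcof_of_K1XN (K1_of_A36_seed8 hA hS) hX hN

/-- Line 22 (conformal-exit) on the re-typed slot, no basin: `K1(1/2^6) → X → N → Theses.BalabanLadder.IRcof`. -/
theorem IRcof_of_exit64cof (hK : CofinalExitAt (1 / 2 ^ 6)) (hX : AFToColdPressure) (hN : IRnsc) :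
    Summit.QuantumFields.YangMills.Theses.BalabanLadder.IRcof :=
  IRcof_of_K1XN (K1_of_exit64cof hK) hX hN

/-- **Summit probe (PROVED over the route file rev 12): the spine's own `closes` with line 20's bill in the `IRcof` slot** —
the five other leaves BY NAME.  A conditional: nothing is proved about the Yang–Mills mass gap. -/
theorem yangMills_of_line20 (hUV : UV) (hSeam : UVSeamRec) (hNT : NT)
    (hA : AbstractBasin (1 / 2 ^ 3) (1 / 24)) (hK : CofinalExitAt (1 / 2 ^ 3)) (hX : AFToColdPressure) (hN : IRnsc)
    (hROT : ROT) (hOther : UVOtherGroups) : YangMills :=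
  Summit.QuantumFields.YangMills.Theses.BalabanLadder.closes hUV hSeam hNT (IRcof_of_A36_seed8cof hA hK hX hN) hROT hOther

end Summit.QuantumFields.YangMills.Cruxes.IR.BasinTransferCofinal

end
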